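import Summits.ResolutionOfSingularities.ResolutionOfSingularities.Theorems.FrobeniusLadderFInjectiveMacaulayficationBlowupFiModel
import HarnessLib

/-!
# The affine blow-up glue in stalk form (E6″, crux `FInjectiveMacaulayfication`)

Support file for crux stmt-ResolutionOfSingularities-15315 (`FrobeniusLadder.FInjectiveMacaulayfication`,
line `Sketch`, lead seat c5, cycle 6): the registered helper stub `stub_affineBlowupStalkClause`.

`R` a Noetherian domain of characteristic `p`, `I = (x₁, …, x_r) ≠ 0` (presented by `x` and the memberships
`hxI i : xᵢ ∈ I`). If `R_P` satisfies the crux's full stalk clause (domain; every system of parameters weakly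
regular; parameter ideals Frobenius closed, inline form) at every prime `P ⊉ I`, and for every non-zero
generator `xᵢ` the chart ring `R[I/xᵢ] = (R[It])_{(xᵢt)}` satisfies the Cohen–Macaulay + Frobenius-closed
clause at each MAXIMAL ideal containing `xᵢ/1`, then EVERY STALK of the blowing up `affineBlowup I = Proj R[It]`
satisfies the full clause.

This is E6′ (`BlowupFiModel.blowupFiModel_of_maximal`, which packages the same conclusion as
`∃ X' π, …` with `X' = affineBlowup (span (range x))`) read on the stalks of `affineBlowup I` itself, as the
lead's global glue E7 over non-affine schemes needs it: after substituting the presentation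
`Ideal.span (Set.range x) = I`, every point `y` lies in the chart of a non-zero generator `xᵢ` with
`𝒪_y ≃+* A_q`, `A = (R[It])_{(xᵢt)}` (`StalkChartIso.stub_stalkChartIso`); the chart ring satisfies the clause
at every prime (`BlowupFiModel.chart_fiClause_of_maximal`); transport along the ring isomorphism
(`MulEquiv.isDomain`, `DegreeZeroDescent.inlineClause_of_ringEquiv`).

References: The Stacks Project, Tag 0804 (affine blowup algebras cover the blowing up), Tag 02OS
(isomorphism off the centre); the rest is folklore.
-/

-- single-problem summit: the doubled namespace component is forced
set_option linter.dupNamespace false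

noncomputable section

namespace Summit.ResolutionOfSingularities.ResolutionOfSingularities.Theorems.FInjectiveMacaulayfication.AffineBlowupStalkClause

open AlgebraicGeometry CategoryTheory Literature.AlgebraicGeometry.Resolution

/-- **E6″ THE AFFINE BLOW-UP GLUE IN STALK FORM** (registered stub `stub_affineBlowupStalkClause` of crux
stmt-ResolutionOfSingularities-15315, line `Sketch`): `R` a Noetherian domain of characteristic `p`,
`I = (x₁,…,x_r) ≠ 0`. If `R_P` satisfies the full stalk clause at every prime `P ⊉ I` and, for every
non-zero generator `xᵢ`, the chart ring `R[I/xᵢ] = (R[It])_{(xᵢt)}` satisfies the Cohen–Macaulay +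
Frobenius-closed clause at each MAXIMAL ideal containing `xᵢ/1`, then every stalk of `affineBlowup I`
is a domain all of whose systems of parameters are weakly regular with Frobenius-closed parameter ideals
(stalks are localizations of the chart rings at the generators, `StalkChartIso.stub_stalkChartIso`; the
chart rings satisfy the clause at every prime, `BlowupFiModel.chart_fiClause_of_maximal`; transport along
the stalk isomorphism). [folklore] -/
theorem stub_affineBlowupStalkClause : ∀ (p : ℕ) [Fact p.Prime] (R : Type) [CommRing R] [IsDomain R]
    [IsNoetherianRing R] [CharP R p] (I : Ideal R) (r : ℕ) (x : Fin r → R) (hxI : ∀ i, x i ∈ I),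
    Ideal.span (Set.range x) = I → I ≠ ⊥ →
    (∀ (P : Ideal R) [P.IsPrime], ¬ I ≤ P →
      IsDomain (Localization.AtPrime P) ∧
      ∀ d : ℕ, ringKrullDim (Localization.AtPrime P) = d → ∀ s : Fin d → Localization.AtPrime P,
        (Ideal.span (Set.range s)).radical.IsMaximal →
          RingTheory.Sequence.IsWeaklyRegular (Localization.AtPrime P) (List.ofFn s) ∧
          ∀ y : Localization.AtPrime P, (∃ e : ℕ, y ^ p ^ e ∈ Ideal.span
            ((fun z : Localization.AtPrime P => z ^ p ^ e) ''
              (Ideal.span (Set.range s) : Set (Localization.AtPrime P)))) → y ∈ Ideal.span (Set.range s)) →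
    (∀ (i : Fin r), x i ≠ 0 →
      ∀ (Q : Ideal (HomogeneousLocalization.Away (reesGrading I) (reesT (x i) (hxI i)))) [Q.IsMaximal],
      reesChartBase (x i) (hxI i) (x i) ∈ Q →
      ∀ d : ℕ, ringKrullDim (Localization.AtPrime Q) = d → ∀ s : Fin d → Localization.AtPrime Q,
        (Ideal.span (Set.range s)).radical.IsMaximal →
          RingTheory.Sequence.IsWeaklyRegular (Localization.AtPrime Q) (List.ofFn s) ∧
          ∀ y : Localization.AtPrime Q, (∃ e : ℕ, y ^ p ^ e ∈ Ideal.span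
            ((fun z : Localization.AtPrime Q => z ^ p ^ e) ''
              (Ideal.span (Set.range s) : Set (Localization.AtPrime Q)))) → y ∈ Ideal.span (Set.range s)) →
    ∀ y : ↥(affineBlowup I), IsDomain ((affineBlowup I).presheaf.stalk y) ∧
      ∀ d : ℕ, ringKrullDim ((affineBlowup I).presheaf.stalk y) = d →
        ∀ s : Fin d → (affineBlowup I).presheaf.stalk y, (Ideal.span (Set.range s)).radical.IsMaximal →
          RingTheory.Sequence.IsWeaklyRegular ((affineBlowup I).presheaf.stalk y) (List.ofFn s) ∧
          ∀ z : (affineBlowup I).presheaf.stalk y, (∃ e : ℕ, z ^ p ^ e ∈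
              Ideal.span ((fun w : (affineBlowup I).presheaf.stalk y => w ^ p ^ e) ''
                (Ideal.span (Set.range s) : Set ((affineBlowup I).presheaf.stalk y)))) →
            z ∈ Ideal.span (Set.range s) := by
  intro p _ R _ _ _ _ I r x hxI hI _ hoff hon y
  -- present the centre by its generators: `I = (x₁, …, x_r)`
  subst hI
  -- `y` lies in the chart of a non-zero generator `xᵢ`, with stalk `𝒪_y ≃ A_q`, `A = (R[It])_{(xᵢt)}`
  obtain ⟨i, q, hxi, ⟨e⟩⟩ := StalkChartIso.stub_stalkChartIso R r x y
  -- primes not containing `xᵢ` do not contain `I`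
  have hoff' : ∀ (P : Ideal R) [P.IsPrime], x i ∉ P →
      IsDomain (Localization.AtPrime P) ∧
      ∀ d : ℕ, ringKrullDim (Localization.AtPrime P) = d → ∀ s : Fin d → Localization.AtPrime P,
        (Ideal.span (Set.range s)).radical.IsMaximal →
          RingTheory.Sequence.IsWeaklyRegular (Localization.AtPrime P) (List.ofFn s) ∧
          ∀ y : Localization.AtPrime P, (∃ e : ℕ, y ^ p ^ e ∈ Ideal.span
            ((fun z : Localization.AtPrime P => z ^ p ^ e) ''
              (Ideal.span (Set.range s) : Set (Localization.AtPrime P)))) → y ∈ Ideal.span (Set.range s) :=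
    fun P _ hxP => hoff P fun hle => hxP (hle (hxI i))
  -- the chart ring satisfies the full clause at every prime (E6′, chart form)
  obtain ⟨hdom, hq⟩ := BlowupFiModel.chart_fiClause_of_maximal p (x i) (hxI i) hxi hoff' (hon i hxi)
    q.asIdeal
  -- transport along the stalk isomorphism
  haveI := hdom
  exact ⟨MulEquiv.isDomain (Localization.AtPrime q.asIdeal) e.toMulEquiv,
    DegreeZeroDescent.inlineClause_of_ringEquiv p e.symm hq⟩

end Summit.ResolutionOfSingularities.ResolutionOfSingularities.Theorems.FInjectiveMacaulayfication.AffineBlowupStalkClause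

end
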